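import Literature.Geometry.Riemannian.UniformlyReifenberg
import Mathlib.Analysis.SpecialFunctions.Trigonometric.Bounds
import Mathlib.Analysis.InnerProductSpace.Projection.FiniteDimensional
import Mathlib.Analysis.Normed.Module.Connected
import HarnessLib

/-!
# The round sphere is uniformly `(ε, min(ε, 1))`-Reifenberg

The model case of the uniform Reifenberg condition of Cheeger–Colding 1997 ((4.6) p. 431,
Appendix 1 p. 457; `Literature.Geometry.Riemannian.IsUniformlyReifenberg`): small balls of the unit
round sphere `(Sⁿ, ∠)` are almost Euclidean on their own scale. For every `ε > 0` the great-circle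
sphere `GreatCircleSphere n` (`Sⁿ ⊂ ℝⁿ⁺¹` with `dist = ∠ = arccos ⟪·, ·⟫`) is uniformly
`(ε, min ε 1)`-Reifenberg (`isUniformlyReifenberg_greatCircleSphere`, every `n`), and so is the
Riemannian round sphere `(Sⁿ, d_{g_round})`, `n ≥ 1`, in the sense of `IsUniformlyReifenbergRiem`
(`isUniformlyReifenbergRiem_roundSphere`, through `d_{g_round} = ∠`, `riemannianEDist_roundSphere`,
and the isometry invariance of `𝓜(n, ε, r)`). This is the hypothesis "`Z₂ = Sⁿ ∈ 𝓜(n, ε, r)`" when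
Cheeger–Colding's Thm A.1.3 is applied at the sphere (sphere stability, Thm A.1.12 at `Sⁿ`).

RELATION TO `RoundSphereReifenberg.lean`. That sibling file (seat of
`CheegerColding1997_sphereStability`) proves the same geometric fact in an ad hoc rendering — a map
`Φ : ℝⁿ → Sⁿ` built from the EXPONENTIAL map, onto the OPEN ball `∠(y, ·) < s`, distortion `≤ s³`,
`n ≥ 1`, `r = min(1, √ε)`. Here the fact is delivered in the vocabulary of the definition file
(closed balls, an `(ε s)`-approximation FROM the spherical ball TO the Euclidean one, packaged as
`IsUniformlyReifenberg` / `IsUniformlyReifenbergRiem`) by a different and shorter chart, the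
ORTHOGRAPHIC projection `x ↦ x − ⟪p, x⟫ p` onto the tangent hyperplane `p^⊥ ≅ ℝⁿ` (Mathlib's
`((ℝ ∙ p)ᗮ).orthogonalProjectionOnto`), which is linear in the ambient space; it needs no
hypothesis on `n`.

THE ESTIMATES on the cap `∠(p, ·) ≤ s`, `s ≤ 1` (all [folklore]):

* `‖x − ⟪p,x⟫p‖ = sin ∠(p, x) ≤ s` (`norm_sub_inner_smul_le_of_angle_le`): the chart maps the cap
  into `B̄_s(0) ⊂ p^⊥`;
* the chart does not increase chordal distances and loses at most
  `|⟪p, x − y⟫| = |cos ∠(p,x) − cos ∠(p,y)| ≤ s²/2` (`norm_sub_norm_sub_inner_smul_le`,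
  `abs_inner_sub_inner_le_of_angle_le`);
* chord versus arc: `0 ≤ ∠(x, y) − ‖x − y‖ ≤ ∠(x, y)³/24 ≤ s³/3` as `∠(x, y) ≤ 2s`
  (`angle_sub_norm_sub_le_cube`: `‖x − y‖ = 2 sin(∠/2)` and Mathlib's `u − u³/6 < sin u`);
* so the distortion against `∠` is `≤ s²/2 + s³/3 ≤ s² ≤ ε s` for `s ≤ min(ε, 1)`
  (`abs_norm_sub_sub_angle_le_of_angle_le`);
* density: `v ⊥ p` with `‖v‖ = t ≤ s` is the chart image of the cap point
  `cos t · p + (sin t / t) · v` up to `t − sin t ≤ t³/6 ≤ ε s` (`exists_unit_angle_le_chart_near`).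

The constants are `1 − O(s²)`, as for the exponential chart.

## References

* J. Cheeger, T. H. Colding, J. Differential Geom. 46 (1997) 406–480: (4.6) p. 431, Appendix 1
  p. 457 (`𝓜(n, ε, r)`; Thm A.1.3 with `Z₂` a smooth manifold), Thm A.1.12 p. 459.
  [CheegerColding1997]
-/

noncomputable section

open Metric Set Function InnerProductGeometry
open scoped RealInnerProductSpace
open Literature.Geometry.MetricGeometry

namespace Literature.Geometry.Riemannian

/-! ### §1. The orthographic chart `w ↦ w − ⟪p, w⟫ p` at a unit vector `p` -/

section OrthoChart

variable {V : Type*} [NormedAddCommGroup V] [InnerProductSpace ℝ V]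

/-- Mathlib's orthogonal projection onto the hyperplane `(ℝ ∙ p)ᗮ` of a unit vector `p` is the
orthographic chart `w ↦ w − ⟪p, w⟫ p`. [folklore] -/
theorem coe_orthogonalProjectionOnto_orthogonal_singleton {p : V} (hp : ‖p‖ = 1) (w : V) :
    (((ℝ ∙ p)ᗮ).orthogonalProjectionOnto w : V) = w - ⟪p, w⟫ • p := by
  rw [Submodule.coe_orthogonalProjectionOnto_apply, Submodule.starProjection_orthogonal_val,
    Submodule.starProjection_unit_singleton ℝ hp]

/-- The chart is linear: differences of chart values are chart values of differences. [folklore] -/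
theorem sub_inner_smul_sub_sub_inner_smul (p x y : V) :
    (x - ⟪p, x⟫ • p) - (y - ⟪p, y⟫ • p) = (x - y) - ⟪p, x - y⟫ • p := by
  rw [inner_sub_right, sub_smul]
  abel

/-- Pythagoras for the chart: `‖w − ⟪p,w⟫p‖² = ‖w‖² − ⟪p, w⟫²` (`‖p‖ = 1`). [folklore] -/
theorem norm_sub_inner_smul_sq {p : V} (hp : ‖p‖ = 1) (w : V) :
    ‖w - ⟪p, w⟫ • p‖ ^ 2 = ‖w‖ ^ 2 - ⟪p, w⟫ ^ 2 := by
  have h1 : ⟪w, ⟪p, w⟫ • p⟫ = ⟪p, w⟫ ^ 2 := by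
    rw [real_inner_smul_right, real_inner_comm p w, sq]
  have h2 : ‖⟪p, w⟫ • p‖ ^ 2 = ⟪p, w⟫ ^ 2 := by
    rw [norm_smul, hp, mul_one, Real.norm_eq_abs, sq_abs]
  rw [norm_sub_sq_real, h1, h2]
  ring

/-- The chart does not increase norms. [folklore] -/
theorem norm_sub_inner_smul_le {p : V} (hp : ‖p‖ = 1) (w : V) : ‖w - ⟪p, w⟫ • p‖ ≤ ‖w‖ := by
  refine (sq_le_sq₀ (norm_nonneg _) (norm_nonneg _)).1 ?_
  rw [norm_sub_inner_smul_sq hp]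
  linarith [sq_nonneg ⟪p, w⟫]

/-- **What the chart loses against the chord**: `‖w‖ − ‖w − ⟪p,w⟫p‖ ≤ |⟪p, w⟫|` (from
`a² = b² + c²`, `0 ≤ b ≤ a`). [folklore] -/
theorem norm_sub_norm_sub_inner_smul_le {p : V} (hp : ‖p‖ = 1) (w : V) :
    ‖w‖ - ‖w - ⟪p, w⟫ • p‖ ≤ |⟪p, w⟫| := by
  have hab : ‖w - ⟪p, w⟫ • p‖ ≤ ‖w‖ := norm_sub_inner_smul_le hp w
  have hb : 0 ≤ ‖w - ⟪p, w⟫ • p‖ := norm_nonneg _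
  have h : ‖w - ⟪p, w⟫ • p‖ ^ 2 = ‖w‖ ^ 2 - |⟪p, w⟫| ^ 2 := by
    rw [sq_abs]; exact norm_sub_inner_smul_sq hp w
  have h1 : (‖w‖ - ‖w - ⟪p, w⟫ • p‖) ^ 2 ≤ |⟪p, w⟫| ^ 2 := by
    nlinarith [mul_nonneg hb (sub_nonneg.2 hab)]
  exact (sq_le_sq₀ (sub_nonneg.2 hab) (abs_nonneg _)).1 h1

/-! #### On the unit sphere: the cap `∠(p, ·) ≤ s` -/

/-- On the cap `∠(p, x) ≤ s` of the unit sphere the chart has norm `≤ s`: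
`‖x − ⟪p,x⟫p‖ = sin ∠(p, x) ≤ ∠(p, x) ≤ s`. [folklore] -/
theorem norm_sub_inner_smul_le_of_angle_le {p x : V} (hp : ‖p‖ = 1) (hx : ‖x‖ = 1) {s : ℝ}
    (h : angle p x ≤ s) : ‖x - ⟪p, x⟫ • p‖ ≤ s := by
  have h0 : 0 ≤ angle p x := angle_nonneg _ _
  have hsin0 : 0 ≤ Real.sin (angle p x) :=
    Real.sin_nonneg_of_nonneg_of_le_pi h0 (angle_le_pi _ _)
  have hsq : ‖x - ⟪p, x⟫ • p‖ ^ 2 = Real.sin (angle p x) ^ 2 := by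
    rw [norm_sub_inner_smul_sq hp, inner_eq_cos_angle_of_norm_eq_one hp hx, hx]
    nlinarith [Real.sin_sq_add_cos_sq (angle p x)]
  have h1 : ‖x - ⟪p, x⟫ • p‖ = Real.sin (angle p x) :=
    (sq_eq_sq₀ (norm_nonneg _) hsin0).1 hsq
  rw [h1]
  exact (Real.sin_le h0).trans h

/-- On the cap, `⟪p, x⟫ = cos ∠(p, x) ∈ [1 − s²/2, 1]`, so two points of the cap have
`|⟪p, x⟫ − ⟪p, y⟫| ≤ s²/2`. [folklore] -/
theorem abs_inner_sub_inner_le_of_angle_le {p x y : V} (hp : ‖p‖ = 1) (hx : ‖x‖ = 1)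
    (hy : ‖y‖ = 1) {s : ℝ} (hxs : angle p x ≤ s) (hys : angle p y ≤ s) :
    |⟪p, x⟫ - ⟪p, y⟫| ≤ s ^ 2 / 2 := by
  rw [inner_eq_cos_angle_of_norm_eq_one hp hx, inner_eq_cos_angle_of_norm_eq_one hp hy]
  have h0x : 0 ≤ angle p x := angle_nonneg _ _
  have h0y : 0 ≤ angle p y := angle_nonneg _ _
  have hx1 := Real.cos_le_one (angle p x)
  have hy1 := Real.cos_le_one (angle p y)
  have hx2 := Real.one_sub_sq_div_two_le_cos (x := angle p x)
  have hy2 := Real.one_sub_sq_div_two_le_cos (x := angle p y)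
  have hxs2 : angle p x ^ 2 ≤ s ^ 2 := pow_le_pow_left₀ h0x hxs 2
  have hys2 : angle p y ^ 2 ≤ s ^ 2 := pow_le_pow_left₀ h0y hys 2
  rw [abs_le]
  constructor <;> linarith

/-- **Chord versus arc, cubic accuracy**: for unit vectors,
`∠(x, y) − ‖x − y‖ ≤ ∠(x, y)³/24` (`‖x − y‖ = 2 sin(∠/2)` and `u − u³/6 ≤ sin u`). [folklore] -/
theorem angle_sub_norm_sub_le_cube {x y : V} (hx : ‖x‖ = 1) (hy : ‖y‖ = 1) :
    angle x y - ‖x - y‖ ≤ angle x y ^ 3 / 24 := by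
  rw [norm_sub_eq_two_mul_sin_half_angle hx hy]
  rcases (angle_nonneg x y).eq_or_lt with h0 | hpos
  · rw [← h0]
    simp
  · have h := Real.sin_gt_sub_cube (x := angle x y / 2) (by linarith)
    nlinarith [h]

/-- **Distortion of the orthographic chart on a cap**: for unit `x, y` with `∠(p, x), ∠(p, y) ≤ s`
and `∠(x, y) ≤ 2s`, `|‖(x − ⟪p,x⟫p) − (y − ⟪p,y⟫p)‖ − ∠(x, y)| ≤ s²/2 + s³/3`. [folklore] -/
theorem abs_norm_sub_sub_angle_le_of_angle_le {p x y : V} (hp : ‖p‖ = 1) (hx : ‖x‖ = 1)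
    (hy : ‖y‖ = 1) {s : ℝ} (hxs : angle p x ≤ s) (hys : angle p y ≤ s)
    (hxy : angle x y ≤ 2 * s) :
    |‖(x - ⟪p, x⟫ • p) - (y - ⟪p, y⟫ • p)‖ - angle x y| ≤ s ^ 2 / 2 + s ^ 3 / 3 := by
  have hs : 0 ≤ s := (angle_nonneg _ _).trans hxs
  rw [sub_inner_smul_sub_sub_inner_smul]
  -- loss of the chart against the chord
  have h1 : ‖x - y‖ - ‖(x - y) - ⟪p, x - y⟫ • p‖ ≤ s ^ 2 / 2 := by
    refine (norm_sub_norm_sub_inner_smul_le hp (x - y)).trans ?_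
    rw [inner_sub_right]
    exact abs_inner_sub_inner_le_of_angle_le hp hx hy hxs hys
  have h1' : ‖(x - y) - ⟪p, x - y⟫ • p‖ ≤ ‖x - y‖ := norm_sub_inner_smul_le hp _
  -- chord versus arc
  have h2 : angle x y - ‖x - y‖ ≤ s ^ 3 / 3 := by
    refine (angle_sub_norm_sub_le_cube hx hy).trans ?_
    have h3 : angle x y ^ 3 ≤ (2 * s) ^ 3 := pow_le_pow_left₀ (angle_nonneg _ _) hxy 3
    nlinarith [h3]
  have h2' : ‖x - y‖ ≤ angle x y := norm_sub_le_angle hx hy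
  rw [abs_le]
  constructor <;> nlinarith [sq_nonneg s, pow_nonneg hs 3]

/-- **Cap points over a given tangent vector** (density of the chart image): for a unit vector
`p`, `v ⊥ p` with `‖v‖ ≤ s ≤ 1`, the unit vector `x = cos ‖v‖ · p + (sin ‖v‖/‖v‖) · v` has
`∠(p, x) = ‖v‖ ≤ s` and `‖(x − ⟪p,x⟫p) − v‖ = ‖v‖ − sin ‖v‖ ≤ s³/6`. [folklore] -/
theorem exists_unit_angle_le_chart_near {p v : V} (hp : ‖p‖ = 1) (hpv : ⟪p, v⟫ = 0) {s : ℝ}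
    (hvs : ‖v‖ ≤ s) (hs1 : s ≤ 1) :
    ∃ x : V, ‖x‖ = 1 ∧ angle p x ≤ s ∧ ‖(x - ⟪p, x⟫ • p) - v‖ ≤ s ^ 3 / 6 := by
  have hs : 0 ≤ s := (norm_nonneg v).trans hvs
  have hp0 : p ≠ 0 := by
    rintro rfl
    rw [norm_zero] at hp
    exact zero_ne_one hp
  rcases eq_or_ne v 0 with rfl | hv0
  · refine ⟨p, hp, ?_, ?_⟩
    · rw [angle_self hp0]
      exact hs
    · rw [real_inner_self_eq_norm_sq, hp, one_pow, one_smul, sub_self, sub_zero, norm_zero]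
      positivity
  set t : ℝ := ‖v‖ with ht
  have ht0 : 0 < t := norm_pos_iff.2 hv0
  have htπ : t ≤ Real.pi := (hvs.trans hs1).trans (by linarith [Real.two_le_pi])
  set x : V := Real.cos t • p + (Real.sin t / t) • v with hx
  have hpx : ⟪p, x⟫ = Real.cos t := by
    rw [hx, inner_add_right, real_inner_smul_right, real_inner_smul_right, hpv,
      real_inner_self_eq_norm_sq, hp]
    ring
  have hxn : ‖x‖ = 1 := by
    have h1 : ‖Real.cos t • p‖ = |Real.cos t| := by
      rw [norm_smul, hp, mul_one, Real.norm_eq_abs]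
    have h2 : ‖(Real.sin t / t) • v‖ = |Real.sin t| := by
      rw [norm_smul, Real.norm_eq_abs, ← ht, abs_div, abs_of_pos ht0, div_mul_cancel₀ _ ht0.ne']
    have h3 : ⟪Real.cos t • p, (Real.sin t / t) • v⟫ = 0 := by
      rw [real_inner_smul_left, real_inner_smul_right, hpv, mul_zero, mul_zero]
    have hsq : ‖x‖ ^ 2 = 1 := by
      rw [hx, norm_add_sq_real, h1, h2, h3, sq_abs, sq_abs, mul_zero, add_zero,
        Real.cos_sq_add_sin_sq]
    have h := (sq_eq_sq₀ (norm_nonneg x) zero_le_one).1 (by rw [hsq, one_pow])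
    exact h
  have hang : angle p x = t := by
    rw [angle, hpx, hp, hxn, one_mul, div_one, Real.arccos_cos ht0.le htπ]
  refine ⟨x, hxn, hang ▸ hvs, ?_⟩
  have hchart : (x - ⟪p, x⟫ • p) - v = (Real.sin t / t - 1) • v := by
    rw [hpx, hx, sub_smul, one_smul]
    abel
  have hcoef : Real.sin t / t - 1 ≤ 0 := by
    rw [sub_nonpos, div_le_one ht0]
    exact Real.sin_le ht0.le
  rw [hchart, norm_smul, Real.norm_eq_abs, ← ht, abs_of_nonpos hcoef, neg_sub]
  -- `(1 - sin t / t) * t = t - sin t ≤ t³/6 ≤ s³/6`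
  have h1 : (1 - Real.sin t / t) * t = t - Real.sin t := by
    field_simp
  rw [h1]
  have h2 := Real.sin_gt_sub_cube ht0
  have h3 : t ^ 3 ≤ s ^ 3 := pow_le_pow_left₀ ht0.le hvs 3
  linarith

end OrthoChart

/-! ### §2. The great-circle sphere is uniformly `(ε, min ε 1)`-Reifenberg -/

section Sphere

open scoped EuclideanSpace

variable {n : ℕ}

/-- **Small caps of `Sⁿ` are almost Euclidean**: for `z ∈ Sⁿ` and `0 < s ≤ 1`, the orthographic
chart (Mathlib's orthogonal projection onto `(ℝ ∙ z)ᗮ ≅ ℝⁿ`) maps the closed great-circle ball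
`B̄_s(z)` to the closed ball `B̄_s(0)` of the tangent hyperplane with distortion `≤ s²/2 + s³/3`
and `(s³/6)`-dense image; in particular it is a `(δ s)`-GH approximation whenever
`s²/2 + s³/3 ≤ δ s`. [folklore] -/
theorem exists_isGHApprox_cap_greatCircleSphere (z : GreatCircleSphere n) {s δ : ℝ} (hs : 0 < s)
    (hs1 : s ≤ 1) (hδ : s ^ 2 / 2 + s ^ 3 / 3 ≤ δ * s) :
    ∃ f : closedBall z s →
        closedBall (0 : (ℝ ∙ (z.val : EuclideanSpace ℝ (Fin (n + 1))))ᗮ) s,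
      IsGHApprox (δ * s) f := by
  set K : Submodule ℝ (EuclideanSpace ℝ (Fin (n + 1))) := (ℝ ∙ z.val)ᗮ with hK
  have hp : ‖z.val‖ = 1 := z.norm_val
  -- density constant
  have hδ' : s ^ 3 / 6 ≤ δ * s := le_trans (by nlinarith [pow_pos hs 2, pow_pos hs 3]) hδ
  -- the chart and its values
  set P : EuclideanSpace ℝ (Fin (n + 1)) → K := fun w ↦ K.orthogonalProjectionOnto w with hP
  have hPval : ∀ w, (P w : EuclideanSpace ℝ (Fin (n + 1))) = w - ⟪z.val, w⟫ • z.val := fun w ↦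
    coe_orthogonalProjectionOnto_orthogonal_singleton hp w
  have hmem : ∀ x : closedBall z s, P x.1.val ∈ closedBall (0 : K) s := fun x ↦ by
    rw [mem_closedBall_zero_iff, ← Submodule.norm_coe, hPval]
    exact norm_sub_inner_smul_le_of_angle_le hp x.1.norm_val (mem_closedBall'.1 x.2)
  refine ⟨fun x ↦ ⟨P x.1.val, hmem x⟩, fun x y ↦ ?_, fun w ↦ ?_⟩
  · -- distortion
    have hxs : angle z.val x.1.val ≤ s := mem_closedBall'.1 x.2
    have hys : angle z.val y.1.val ≤ s := mem_closedBall'.1 y.2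
    have hxy : angle x.1.val y.1.val ≤ 2 * s := by
      have h := dist_triangle x.1 z y.1
      rw [GreatCircleSphere.dist_eq, GreatCircleSphere.dist_eq, GreatCircleSphere.dist_eq,
        angle_comm x.1.val z.val] at h
      linarith
    have hd1 : dist (⟨P x.1.val, hmem x⟩ : closedBall (0 : K) s) ⟨P y.1.val, hmem y⟩ =
        ‖(x.1.val - ⟪z.val, x.1.val⟫ • z.val) - (y.1.val - ⟪z.val, y.1.val⟫ • z.val)‖ := by
      rw [Subtype.dist_eq, dist_eq_norm, ← Submodule.norm_coe, Submodule.coe_sub, hPval, hPval]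
    have hd2 : dist x y = angle x.1.val y.1.val := rfl
    rw [hd1, hd2]
    exact (abs_norm_sub_sub_angle_le_of_angle_le hp x.1.norm_val y.1.norm_val hxs hys hxy).trans hδ
  · -- density
    have hw : ‖((w : K) : EuclideanSpace ℝ (Fin (n + 1)))‖ ≤ s := by
      rw [Submodule.norm_coe]
      exact mem_closedBall_zero_iff.1 w.2
    have hpw : ⟪z.val, ((w : K) : EuclideanSpace ℝ (Fin (n + 1)))⟫ = 0 :=
      Submodule.mem_orthogonal_singleton_iff_inner_right.1 (w : K).2
    obtain ⟨x, hx1, hxs, hxw⟩ := exists_unit_angle_le_chart_near hp hpw hw hs1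
    set a : GreatCircleSphere n := GreatCircleSphere.ofSphere ⟨x, by simp [hx1]⟩ with ha
    have hav : a.val = x := rfl
    have has : a ∈ closedBall z s := by
      rw [mem_closedBall', GreatCircleSphere.dist_eq, hav]
      exact hxs
    refine ⟨⟨a, has⟩, ?_⟩
    have hd : dist (⟨P a.val, hmem ⟨a, has⟩⟩ : closedBall (0 : K) s) w =
        ‖(x - ⟪z.val, x⟫ • z.val) - ((w : K) : EuclideanSpace ℝ (Fin (n + 1)))‖ := by
      rw [Subtype.dist_eq, dist_eq_norm, ← Submodule.norm_coe, Submodule.coe_sub, hPval, hav]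
    rw [hd]
    exact hxw.trans hδ'

variable (n) in
/-- **The unit round sphere with its great-circle metric is uniformly `(ε, min ε 1)`-Reifenberg**
for every `ε` (of interest for `ε > 0`; vacuous otherwise): `(Sⁿ, ∠) ∈ 𝓜(n, ε, min(ε, 1))` — at
scales `s ≤ min(ε, 1)` the orthographic chart of the cap `B̄_s(z)` onto the tangent hyperplane
`z^⊥ ≅ ℝⁿ` has distortion `≤ s²/2 + s³/3 ≤ ε s` and `(s³/6)`-dense image in `B̄_s(0)`. The model
member of Cheeger–Colding's class `𝓜(n, ε, r)` ("`Z₂` a smooth Riemannian manifold", Thm A.1.3,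
p. 457). [folklore] -/
theorem isUniformlyReifenberg_greatCircleSphere (ε : ℝ) :
    IsUniformlyReifenberg n (GreatCircleSphere n) ε (min ε 1) := by
  intro z
  have hz0 : (z.val : EuclideanSpace ℝ (Fin (n + 1))) ≠ 0 := by
    intro h
    have := z.norm_val
    rw [h, norm_zero] at this
    exact zero_ne_one this
  have hK : Module.finrank ℝ (ℝ ∙ (z.val : EuclideanSpace ℝ (Fin (n + 1))))ᗮ = n :=
    Submodule.finrank_orthogonal_span_singleton hz0
  refine isReifenbergPoint_of_finrank_eq hK fun s hs hsr ↦ ?_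
  have hs1 : s ≤ 1 := hsr.trans (min_le_right _ _)
  have hsε : s ≤ ε := hsr.trans (min_le_left _ _)
  refine exists_isGHApprox_cap_greatCircleSphere z hs hs1 ?_
  -- `s²/2 + s³/3 ≤ s² ≤ ε s`
  nlinarith [mul_le_mul_of_nonneg_left hsε hs.le, mul_le_mul_of_nonneg_left hs1 (sq_nonneg s)]

variable (n) in
/-- `(Sⁿ, ∠)` is uniformly `(ε, r)`-Reifenberg whenever `r ≤ min(ε, 1)`. [folklore] -/
theorem isUniformlyReifenberg_greatCircleSphere_of_le {ε r : ℝ} (hr : r ≤ min ε 1) :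
    IsUniformlyReifenberg n (GreatCircleSphere n) ε r :=
  (isUniformlyReifenberg_greatCircleSphere n ε).mono le_rfl hr

variable (n) in
/-- For every `ε > 0` there is `r > 0` with `(Sⁿ, ∠) ∈ 𝓜(n, ε, r)`. [folklore] -/
theorem exists_isUniformlyReifenberg_greatCircleSphere {ε : ℝ} (hε : 0 < ε) :
    ∃ r : ℝ, 0 < r ∧ IsUniformlyReifenberg n (GreatCircleSphere n) ε r :=
  ⟨min ε 1, lt_min hε one_pos, isUniformlyReifenberg_greatCircleSphere n ε⟩

end Sphere

/-! ### §3. The Riemannian round sphere -/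

section RoundSphere

open scoped Manifold ContDiff EuclideanSpace
open Bundle Manifold

variable {n : ℕ}

/-- The unit sphere `Sⁿ ⊂ ℝⁿ⁺¹` is preconnected for `n ≥ 1` (Mathlib's `isPreconnected_sphere`).
[folklore] -/
theorem preconnectedSpace_unitSphere (hn : 1 ≤ n) :
    PreconnectedSpace (sphere (0 : EuclideanSpace ℝ (Fin (n + 1))) 1) := by
  refine Subtype.preconnectedSpace (isPreconnected_sphere ?_ 0 1)
  rw [← Module.finrank_eq_rank, finrank_euclideanSpace_fin]
  exact_mod_cast Nat.succ_le_succ hn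

/-- **The Riemannian round sphere is uniformly `(ε, min ε 1)`-Reifenberg** (`n ≥ 1`; every `ε`):
`IsUniformlyReifenbergRiem n (roundSphereMetric n) ε (min ε 1)` — its length distance is the angle
(`riemannianEDist_roundSphere`), so `(Sⁿ, d_{g_round})` is isometric to `GreatCircleSphere n`, and
`𝓜(n, ε, r)` is isometry invariant (`IsUniformlyReifenberg.of_equiv_of_dist_eq`). Non-vacuity of
the Reifenberg hypothesis of Cheeger–Colding's Thms A.1.2–A.1.3 / A.1.12 at the sphere, in the
tree's Riemannian vocabulary. [folklore] -/
theorem isUniformlyReifenbergRiem_roundSphere (hn : 1 ≤ n) (ε : ℝ) :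
    haveI := preconnectedSpace_unitSphere hn
    IsUniformlyReifenbergRiem n (roundSphereMetric n) ε (min ε 1) := by
  haveI := preconnectedSpace_unitSphere hn
  letI : RiemannianBundle (fun x : sphere (0 : EuclideanSpace ℝ (Fin (n + 1))) 1 ↦
      TangentSpace (𝓡 n) x) :=
    ⟨(roundSphereMetric n).toContinuousRiemannianMetric.toRiemannianMetric⟩
  letI : MetricSpace (sphere (0 : EuclideanSpace ℝ (Fin (n + 1))) 1) :=
    metricSpaceOfRiemannian (𝓡 n) (sphere (0 : EuclideanSpace ℝ (Fin (n + 1))) 1)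
  letI : PseudoMetricSpace (sphere (0 : EuclideanSpace ℝ (Fin (n + 1))) 1) :=
    (metricSpaceOfRiemannian (𝓡 n) (sphere (0 : EuclideanSpace ℝ (Fin (n + 1))) 1)).toPseudoMetricSpace
  rw [isUniformlyReifenbergRiem_iff]
  -- the distance of `(Sⁿ, d_{g_round})` is the angle
  have hdist : ∀ a b : sphere (0 : EuclideanSpace ℝ (Fin (n + 1))) 1,
      dist a b = angle (a : EuclideanSpace ℝ (Fin (n + 1))) b := fun a b ↦ by
    have h : (riemannianEDist (𝓡 n) a b) =
        ENNReal.ofReal (angle (a : EuclideanSpace ℝ (Fin (n + 1))) b) :=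
      riemannianEDist_roundSphere (V := EuclideanSpace ℝ (Fin (n + 1))) hn a b
    change (riemannianEDist (𝓡 n) a b).toReal = _
    rw [h, ENNReal.toReal_ofReal (angle_nonneg _ _)]
  have h := (isUniformlyReifenberg_greatCircleSphere n ε).of_equiv_of_dist_eq
    (GreatCircleSphere.ofSphere (n := n)).symm one_pos fun x y ↦ by
      rw [one_mul, hdist, GreatCircleSphere.dist_eq]
      rfl
  rwa [one_mul] at h

end RoundSphere

end Literature.Geometry.Riemannian

end
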